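import Summits.CriticalPhenomena.PercolationContinuityZ3.Theorems.PercNearOneGluingNoHeavyLowerTailSahiCTCG111CertsMM
import Summits.CriticalPhenomena.PercolationContinuityZ3.Theorems.PercNearOneGluingNoHeavyLowerTailSahiCTCG111CertsLM
import Summits.CriticalPhenomena.PercolationContinuityZ3.Theorems.PercNearOneGluingNoHeavyLowerTailSahiCTCPara1
import Summits.CriticalPhenomena.PercolationContinuityZ3.Theorems.PercNearOneGluingNoHeavyLowerTailSahiCTCG011
import HarnessLib

/-!
# `NoHeavyLowerTail` (crux stmt-CriticalPhenomena-4575), P3 lane: **THE c = 1 COEFFICIENTWISE THRESHOLD CERTIFICATE FOR EVERY PAIR OF COMPLEXES** —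
# `Ñ₁(K_X,K_Z) ∈ ℕ[r]` (g9 §10 THEOREM), as a kernel theorem assembled from the all-live factorisation and the kernel-checked step certificates

Support file (seat `prim-l12-p3`, gen 19; `--supports stmt-CriticalPhenomena-4575`).  Memo `run/shared/lean/prim/prim-l12/FROM-prim-l12-p3-g19-CERTIFICATE-ROAD-G011.md`.
Nothing is asserted about the crux.

g9 §10: "THEOREM (c = 1 coefficientwise threshold certificate; all k).  For every k and all complexes K_X, K_Z on [k]:
Ñ₁ = e₁(Π+e_{≥2})(Π|Y^{≤1}| − |X^{≤1}||Z^{≤1}|) − (1+e₁)Π e_{≥2}|Y^{=1}| − e₁e_{≥2}(|X^{≤1}||Z^{≥2}| + |X^{≥2}||Z^{≤1}|) + e₁(1+e₁)|X^{≥2}||Z^{≥2}| ∈ ℕ[r_1..r_k].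
PROOF.  Simultaneous induction on k for (Ñ₁ = G111, G011, PARA₁) … if the pair is all-live use the factorisation, else choose v not live in X or in Z: cases mm
(hyps G111, PARA₁), lm/ml (hyps G011, G111, PARA₁) certified."  Here exactly that: `coeff_G111V_nonneg` by strong induction on the ground finset with
`coeff_G111V_nonneg_of_allLive`, `coeff_G011V_nonneg` (`…SahiCTCG011`), `coeff_PARA1V_nonneg` (`…SahiCTCPara1`) and the steps `coeff_G111V_step_mm/lm`
(`ml` by `G111V_comm`).  This re-proves — for ALL pairs of up-sets, coefficientwise — the (TC) row of the all-but-one transport certificate (g8's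
`…SahiAllButOne` covered the cylinder pairs as a real inequality).  Axiom closure: standard + the `native_decide` facts of the certificate files.
-/

namespace Summit.CriticalPhenomena.PercolationContinuityZ3.Theorems.SahiCTCForms

open Finset MvPolynomial SahiCTCGenFun

variable {α : Type*} [DecidableEq α]

section main
variable [Fintype α]

/-- **`Ñ₁(K_X,K_Z) = G(1,1,1) ∈ ℕ[r]` for every ground finset and EVERY pair of simplicial complexes** — the c = 1 coefficientwise threshold
certificate (g9 §10) as a kernel theorem: all-live pairs by the factorisation, otherwise delete a non-live vertex and use the certified step
(hypotheses `G011`, `PARA₁` from the companion theorems). [this work] -/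
theorem coeff_G111V_nonneg (V : Finset α) {KX KZ : Finset (Finset α)} (hKX : IsLowerSet (KX : Set (Finset α)))
    (hKZ : IsLowerSet (KZ : Set (Finset α))) (h0X : ∅ ∈ KX) (h0Z : ∅ ∈ KZ) : ∀ n, 0 ≤ (G111V V KX KZ).coeff n := by
  induction V using Finset.strongInduction generalizing KX KZ with
  | H V ih =>
    by_cases hall : ∀ i ∈ V, ({i} : Finset α) ∈ KX ∧ ({i} : Finset α) ∈ KZ
    · exact coeff_G111V_nonneg_of_allLive KX KZ h0X h0Z hall
    · have hall' : ∃ v ∈ V, ¬ (({v} : Finset α) ∈ KX ∧ ({v} : Finset α) ∈ KZ) := by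
        by_contra h
        exact hall fun i hi => by
          by_contra h'
          exact h ⟨i, hi, h'⟩
      obtain ⟨v, hv, hvne⟩ := hall'
      have hind := ih (V.erase v) (erase_ssubset hv) hKX hKZ h0X h0Z
      have hind' := ih (V.erase v) (erase_ssubset hv) hKZ hKX h0Z h0X
      have hG := coeff_G011V_nonneg (V.erase v) hKX hKZ h0X h0Z
      have hG' := coeff_G011V_nonneg (V.erase v) hKZ hKX h0Z h0X
      have hP := coeff_PARA1V_nonneg (V.erase v) hKX hKZ h0X h0Z
      have hP' := coeff_PARA1V_nonneg (V.erase v) hKZ hKX h0Z h0X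
      by_cases hvX : {v} ∈ KX
      · have hvZ : {v} ∉ KZ := fun hz => hvne ⟨hvX, hz⟩
        exact coeff_G111V_step_lm V KX KZ v hv hKX hKZ h0Z hvX hvZ hind hG hP
      · by_cases hvZ : {v} ∈ KZ
        · intro n; rw [G111V_comm KX KZ V]
          exact coeff_G111V_step_lm V KZ KX v hv hKZ hKX h0X hvZ hvX hind' hG' hP' n
        · exact coeff_G111V_step_mm V KX KZ v hv hKX hKZ h0X h0Z hvX hvZ hind hP hP'

/-- The same on the whole finite type: the c = 1 `(TC)`-row polynomial has nonnegative coefficients for every pair of complexes. [this work] -/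
theorem coeff_G111_nonneg {KX KZ : Finset (Finset α)} (hKX : IsLowerSet (KX : Set (Finset α))) (hKZ : IsLowerSet (KZ : Set (Finset α)))
    (h0X : ∅ ∈ KX) (h0Z : ∅ ∈ KZ) : ∀ n, 0 ≤ (G111V (univ : Finset α) KX KZ).coeff n :=
  coeff_G111V_nonneg univ hKX hKZ h0X h0Z

end main

end Summit.CriticalPhenomena.PercolationContinuityZ3.Theorems.SahiCTCForms
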